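import Mathlib
import HarnessLib
import Summits.HubbardSuperconductivity.HubbardSuperconductivity.Theorems.KLProgrammeC4aPPKernelFarSBundle
import Summits.HubbardSuperconductivity.HubbardSuperconductivity.Theorems.KLProgrammeC4aPPKernelMidLawBundle
import Summits.HubbardSuperconductivity.HubbardSuperconductivity.Theorems.KLProgrammeC4aPPKernelTrueKernelD2
import Summits.HubbardSuperconductivity.HubbardSuperconductivity.Theorems.KLProgrammeC4aPPKernelStripEnvelope
import Summits.HubbardSuperconductivity.HubbardSuperconductivity.Theorems.KLProgrammeC4aPPKernelNegPreThermal

/-!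
# Route `KLProgramme` — crux C4a, S3 brick (B4) «(U1)-HYBRID» kernel side, B-1 (vi): THE SIX KERNEL ROWS OF THE SUMMED FIRST-ORDER LAYER
# (`…C4aFirstOrderLayerSum.firstOrderLayer_abs_le`, k3c3-p3 g37: binders `hKd hKc hK0 hK0s hK1 hKs1` of `{Kr : ℝ → ℝ → ℝ}`) FOR THE TRUE pp KERNEL `P/C`,
# THE SMOOTH FAR PIECE `A_s/C` AND THE COMPARABLE-LEVELS PIECE `M_s/C` — in that binder order and in those shapes, plus the concrete twins

Cell `gate-hubbard-kl`, seat hubbard-kl-k3c3-p1 (g19; row «δμ-flow with klAngularMean constant piece»), owner split (R321)(B): the law chain is k3c3-p3's, the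
kernel side this seat's.  Located brick for the (C)-closer lane / the `M₁` assembly (stub (C) `stub_twoLeg_curvature` of `KLRegimeEngineV17F2`,
stmt-HubbardSuperconductivity-20437).

WHY.  The summed first-order layer B-1 (vi) (umklapp as the integrated hypothesis `hUmk` + tangency + Cooper) reads ONE two-variable kernel `Kr` through six rows:
`hKd : ∀ e ∈ [−hi,hi], ContDiff ℝ 1 (Kr e)`, `hKc : Continuous (e,u) ↦ (Kr e)′ u`, `hK0 : e ≠ 0 → |Kr e u| ≤ (max |e| |u|)⁻¹`, `hK0s : |e| ≤ lo → |Kr e u| ≤ (max lo |u|)⁻¹`,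
`hK1 : e ≠ 0 → |(Kr e)′ u| ≤ (max |e| |u|)⁻¹²`, `hKs1 : |e| ≤ lo → |(Kr e)′ u| ≤ (max lo |u|)⁻¹²` — a SUBSET of the umklapp ladder's rows (no `hK2`, no support, no
flatness, no negative-level majorant).  This file discharges them once and for all, for the three kernels the closer can meet:
* **`ppTrueKernel_firstOrderRows`** — `Kr := P/C` (the true kernel itself, no partition): `12B₁+9 ≤ C` (value, `abs_ppTrueKernel_le_inv_max_abs`), `64B₂+120B₁+158+(12B₁+5)K ≤ C`
  with `hi ≤ K·Λ`, `1 ≤ K` (ALL-`u` derivative envelope at near-shell levels, `abs_ppTrueKernelDu_le_inv_max_sq_of_le_mul` + parity), `128B₁+72 ≤ C` (strip,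
  `abs_deriv_ppTrueKernel_strip_le`), `8 ≤ 12B₁+9` (strip value); `contDiff_one_ppTrueKernel`, `continuous_ppTrueKernelDu_comp`;
  **`ppTrueKernel_firstOrderRows_concrete`** — `C := (12B₁+9) + (64B₂+120B₁+158+(12B₁+5)K) + (128B₁+72)`;
* **`ppFarKernelS_firstOrderRows`** — `Kr := A_s/C` (`C₀ᴬ, C₁ᴬ, Cˢ ≤ C`; rows of `…PPKernelFarSRows` / `farSRow_hK0s`); **`ppFarKernelSSplit_firstOrderRows`** — at
  `sκ := ppSplitProfile t₁`, `C := Cᴬ(B₁,B₂,B₃,t₁)` of `ppSplit_rowConstsFarS` (the SAME `Kr` term as the landed `…FarSSplit` umklapp one-calls);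
* **`ppMidKernelS_firstOrderRows`** — `Kr := M_s/C` (`C₀ᴹ, C₁ᴹ, Cˢᴹ ≤ C`; rows of `…PPKernelMidNeg` / `midSRow_hK0s`); **`ppMidKernelSSplit_firstOrderRows`** — at
  `sκ := ppSplitProfile t₁`, `C := Cᴹ(B₁,B₂,B₃,t₁)` of `ppSplit_rowConstsMidS`.
Use: `obtain ⟨hKd, hKc, hK0, hK0s, hK1, hKs1⟩ := pp…_firstOrderRows …` and pass them to `firstOrderLayer_abs_le … (Kr := fun e u => …/C)` verbatim.
Pure real analysis on Literature objects; nothing asserts (C), K3, the window or superconductivity.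
References: BGM 2006 §2.4 (2.36) [cite: BenfattoGiulianiMastropietro2006]; FST II CPAM 51 (1998) §3 [cite: FeldmanSalmhoferTrubowitz1998].
-/

noncomputable section

namespace Summit.HubbardSuperconductivity.HubbardSuperconductivity.Theorems.C4a

set_option linter.dupNamespace false -- summit = problem name (single-conjunct summit), D-0017

open Real Set MeasureTheory
open Literature.MathematicalPhysics.QuantumLattice Literature.Analysis.SpecialFunctions

/-! ## §1 The true kernel `P/C` -/

set_option maxHeartbeats 400000 in
/-- **THE SIX ROWS OF B-1 (vi) FOR `Kr := P/C`** (binder order `hKd, hKc, hK0, hK0s, hK1, hKs1`): any floor `0 < lo ≤ Λ`, level box `hi ≤ K·Λ` (`1 ≤ K`), normalisation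
`12B₁+9 ≤ C`, `64B₂+120B₁+158+(12B₁+5)K ≤ C`, `128B₁+72 ≤ C`. [cite: BenfattoGiulianiMastropietro2006, §2.4 (2.36)] -/
theorem ppTrueKernel_firstOrderRows {β Λ : ℝ} (hβ : 0 < β) (hΛ : 0 < Λ) {B₁ B₂ : ℝ} (hB₁ : ∀ x, |deriv salmhoferCutoff x| ≤ B₁)
    (hB₂ : ∀ x, |deriv (deriv salmhoferCutoff) x| ≤ B₂) {lo hi K C : ℝ} (hlo : 0 < lo) (hloΛ : lo ≤ Λ) (hK : 1 ≤ K) (hhiK : hi ≤ K * Λ) (hC : 0 < C)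
    (hC0 : 12 * B₁ + 9 ≤ C) (hC1 : 64 * B₂ + 120 * B₁ + 158 + (12 * B₁ + 5) * K ≤ C) (hCs : 128 * B₁ + 72 ≤ C) :
    (∀ e ∈ Icc (-hi) hi, ContDiff ℝ 1 (fun v : ℝ => ppTrueKernel β Λ e v / C)) ∧
    (Continuous fun p : ℝ × ℝ => deriv (fun v : ℝ => ppTrueKernel β Λ p.1 v / C) p.2) ∧
    (∀ e ∈ Icc (-hi) hi, e ≠ 0 → ∀ u, |ppTrueKernel β Λ e u / C| ≤ (max |e| |u|)⁻¹) ∧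
    (∀ e ∈ Icc (-lo) lo, ∀ u, |ppTrueKernel β Λ e u / C| ≤ (max lo |u|)⁻¹) ∧
    (∀ e ∈ Icc (-hi) hi, e ≠ 0 → ∀ u, |deriv (fun v : ℝ => ppTrueKernel β Λ e v / C) u| ≤ (max |e| |u|)⁻¹ ^ 2) ∧
    (∀ e ∈ Icc (-lo) lo, ∀ u, |deriv (fun v : ℝ => ppTrueKernel β Λ e v / C) u| ≤ (max lo |u|)⁻¹ ^ 2) := by
  have hB10 : 0 ≤ B₁ := salmhoferB₁_nonneg hB₁
  have hd : ∀ e u : ℝ, deriv (fun v : ℝ => ppTrueKernel β Λ e v / C) u = ppTrueKernelDu β Λ e u / C := fun e u =>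
    ((hasDerivAt_ppTrueKernel_u hβ hΛ hB₁ e u).div_const C).deriv
  refine ⟨fun e _ => (contDiff_one_ppTrueKernel hβ hΛ hB₁ e).div_const C, ?_,
    fun e _ he u => abs_div_le_of_le (abs_ppTrueKernel_le_inv_max_abs hβ hΛ hB₁ he u) hC0 hC (by positivity), fun e he u => ?_,
    fun e he hne u => ?_, fun e he u => ?_⟩
  · have h : (fun p : ℝ × ℝ => deriv (fun v : ℝ => ppTrueKernel β Λ p.1 v / C) p.2) = fun p => ppTrueKernelDu β Λ p.1 p.2 / C :=
      funext fun p => hd p.1 p.2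
    rw [h]
    exact (continuous_ppTrueKernelDu_comp hβ hΛ hB₁ continuous_fst continuous_snd).div_const C
  · have heΛ : |e| ≤ Λ := (abs_le.2 ⟨he.1, he.2⟩).trans hloΛ
    have hm0 : 0 < max lo |u| := lt_max_of_lt_left hlo
    have hmm : (max Λ |u|)⁻¹ ≤ (max lo |u|)⁻¹ := by
      rw [inv_le_inv₀ (lt_max_of_lt_left hΛ) hm0]; exact max_le_max hloΛ le_rfl
    have h8 : (8 : ℝ) ≤ C := by linarith only [hC0, hB10]
    exact abs_div_le_of_le ((abs_ppTrueKernel_strip_le_inv_max hβ hΛ heΛ u).trans (mul_le_mul_of_nonneg_left hmm (by norm_num))) h8 hC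
      (inv_nonneg.2 hm0.le)
  · rw [hd]
    have heabs : |e| ≤ K * Λ := (abs_le.2 ⟨he.1, he.2⟩).trans hhiK
    have key : |ppTrueKernelDu β Λ e u| ≤ (64 * B₂ + 120 * B₁ + 158 + (12 * B₁ + 5) * K) * (max |e| |u|)⁻¹ ^ 2 := by
      rcases hne.lt_or_gt with hneg | hpos
      · have h := abs_ppTrueKernelDu_le_inv_max_sq_of_le_mul hβ hΛ hB₁ hB₂ hK (neg_pos.2 hneg) (by rwa [abs_of_neg hneg] at heabs) (-u)
        rw [ppTrueKernelDu_neg_neg, abs_neg, abs_neg] at h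
        rwa [abs_of_neg hneg]
      · have h := abs_ppTrueKernelDu_le_inv_max_sq_of_le_mul hβ hΛ hB₁ hB₂ hK hpos (by rwa [abs_of_pos hpos] at heabs) u
        rwa [abs_of_pos hpos]
    exact abs_div_le_of_le key hC1 hC (by positivity)
  · rw [deriv_div_const]
    exact abs_div_le_of_le (abs_deriv_ppTrueKernel_strip_le hβ hΛ hB₁ hlo hloΛ e he u) hCs hC (by positivity)

/-- **CONCRETE NORMALISATION FOR `P`**: `ppTrueKernel_firstOrderRows` at `C := (12B₁+9) + (64B₂+120B₁+158+(12B₁+5)K) + (128B₁+72)` — kernel inputs `0 < β`, `0 < Λ`,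
`|χ′| ≤ B₁`, `|χ″| ≤ B₂`, `0 < lo ≤ Λ`, `1 ≤ K`, `hi ≤ K·Λ` only. [cite: BenfattoGiulianiMastropietro2006, §2.4 (2.36)] -/
theorem ppTrueKernel_firstOrderRows_concrete {β Λ : ℝ} (hβ : 0 < β) (hΛ : 0 < Λ) {B₁ B₂ : ℝ} (hB₁ : ∀ x, |deriv salmhoferCutoff x| ≤ B₁)
    (hB₂ : ∀ x, |deriv (deriv salmhoferCutoff) x| ≤ B₂) {lo hi K : ℝ} (hlo : 0 < lo) (hloΛ : lo ≤ Λ) (hK : 1 ≤ K) (hhiK : hi ≤ K * Λ) :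
    (∀ e ∈ Icc (-hi) hi, ContDiff ℝ 1 (fun v : ℝ => ppTrueKernel β Λ e v / (12 * B₁ + 9 + (64 * B₂ + 120 * B₁ + 158 + (12 * B₁ + 5) * K) + (128 * B₁ + 72)))) ∧
    (Continuous fun p : ℝ × ℝ => deriv (fun v : ℝ => ppTrueKernel β Λ p.1 v / (12 * B₁ + 9 + (64 * B₂ + 120 * B₁ + 158 + (12 * B₁ + 5) * K) + (128 * B₁ + 72))) p.2) ∧
    (∀ e ∈ Icc (-hi) hi, e ≠ 0 → ∀ u, |ppTrueKernel β Λ e u / (12 * B₁ + 9 + (64 * B₂ + 120 * B₁ + 158 + (12 * B₁ + 5) * K) + (128 * B₁ + 72))| ≤ (max |e| |u|)⁻¹) ∧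
    (∀ e ∈ Icc (-lo) lo, ∀ u, |ppTrueKernel β Λ e u / (12 * B₁ + 9 + (64 * B₂ + 120 * B₁ + 158 + (12 * B₁ + 5) * K) + (128 * B₁ + 72))| ≤ (max lo |u|)⁻¹) ∧
    (∀ e ∈ Icc (-hi) hi, e ≠ 0 → ∀ u, |deriv (fun v : ℝ => ppTrueKernel β Λ e v / (12 * B₁ + 9 + (64 * B₂ + 120 * B₁ + 158 + (12 * B₁ + 5) * K) + (128 * B₁ + 72))) u| ≤ (max |e| |u|)⁻¹ ^ 2) ∧
    (∀ e ∈ Icc (-lo) lo, ∀ u, |deriv (fun v : ℝ => ppTrueKernel β Λ e v / (12 * B₁ + 9 + (64 * B₂ + 120 * B₁ + 158 + (12 * B₁ + 5) * K) + (128 * B₁ + 72))) u| ≤ (max lo |u|)⁻¹ ^ 2) := by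
  have hB10 : 0 ≤ B₁ := salmhoferB₁_nonneg hB₁
  have hB20 : 0 ≤ B₂ := (abs_nonneg _).trans (hB₂ 0)
  have hK0 : 0 ≤ K := zero_le_one.trans hK
  exact ppTrueKernel_firstOrderRows hβ hΛ hB₁ hB₂ hlo hloΛ hK hhiK (by positivity) (by nlinarith only [hB10, hB20, hK0])
    (by nlinarith only [hB10, hB20, hK0]) (by nlinarith only [hB10, hB20, hK0])

/-! ## §2 The smooth far piece `A_s/C` -/

section FarS

variable {β Λ : ℝ} (hβ : 0 < β) (hΛ : 0 < Λ) {B₁ B₂ : ℝ} (hB₁ : ∀ x, |deriv salmhoferCutoff x| ≤ B₁) (hB₂ : ∀ x, |deriv (deriv salmhoferCutoff) x| ≤ B₂)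
  {κ κ' κ'' : ℝ → ℝ} (hκ : ∀ t, HasDerivAt κ (κ' t) t) (hκ' : ∀ t, HasDerivAt κ' (κ'' t) t) (hκ''c : Continuous κ'')
  {κ₀ κ₁ : ℝ} (hκb : ∀ t ∈ Icc 0 1, |κ t| ≤ κ₀) (hκ'b : ∀ t ∈ Icc 0 1, |κ' t| ≤ κ₁)
  {t₁ : ℝ} (ht₀ : 0 < t₁) (ht25 : t₁ ≤ 2 / 5)
  (hκs : ∀ t, t₁ ≤ t → κ t = 0) (hκ's : ∀ t, t₁ ≤ t → κ' t = 0) (hκ''s : ∀ t, t₁ ≤ t → κ'' t = 0)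
  {lo hi C : ℝ} (hlo : 0 < lo) (hloΛ : lo ≤ Λ) (hC : 0 < C)

set_option maxHeartbeats 400000 in
include hβ hΛ hB₁ hB₂ hκ hκ' hκ''c hκb hκ'b ht₀ ht25 hκs hκ's hκ''s hlo hloΛ hC in
/-- **THE SIX ROWS OF B-1 (vi) FOR `Kr := A_s/C`** (binder order `hKd, hKc, hK0, hK0s, hK1, hKs1`): normalisation `C₀ᴬ = κ₀(12B₁+9) ≤ C`,
`C₁ᴬ = κ₀(64B₂+108B₁+145) + κ₁(12B₁+9) ≤ C`, `Cˢ = κ₀(128B₁+72) + 8κ₁ ≤ C`; profile `κ` of class `C²`, `|κ| ≤ κ₀`, `|κ′| ≤ κ₁` on `[0,1]`, dead above `t₁ ≤ 2/5`.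
[cite: BenfattoGiulianiMastropietro2006, §2.4 (2.36)] -/
theorem ppFarKernelS_firstOrderRows (hC0 : κ₀ * (12 * B₁ + 9) ≤ C) (hC1 : κ₀ * (64 * B₂ + 108 * B₁ + 145) + κ₁ * (12 * B₁ + 9) ≤ C)
    (hCs : κ₀ * (128 * B₁ + 72) + 8 * κ₁ ≤ C) :
    (∀ e ∈ Icc (-hi) hi, ContDiff ℝ 1 (fun v : ℝ => ppFarKernelS β Λ κ lo e v / C)) ∧
    (Continuous fun p : ℝ × ℝ => deriv (fun v : ℝ => ppFarKernelS β Λ κ lo p.1 v / C) p.2) ∧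
    (∀ e ∈ Icc (-hi) hi, e ≠ 0 → ∀ u, |ppFarKernelS β Λ κ lo e u / C| ≤ (max |e| |u|)⁻¹) ∧
    (∀ e ∈ Icc (-lo) lo, ∀ u, |ppFarKernelS β Λ κ lo e u / C| ≤ (max lo |u|)⁻¹) ∧
    (∀ e ∈ Icc (-hi) hi, e ≠ 0 → ∀ u, |deriv (fun v : ℝ => ppFarKernelS β Λ κ lo e v / C) u| ≤ (max |e| |u|)⁻¹ ^ 2) ∧
    (∀ e ∈ Icc (-lo) lo, ∀ u, |deriv (fun v : ℝ => ppFarKernelS β Λ κ lo e v / C) u| ≤ (max lo |u|)⁻¹ ^ 2) := by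
  have hB10 : 0 ≤ B₁ := salmhoferB₁_nonneg hB₁
  have hκ₀ : 0 ≤ κ₀ := (abs_nonneg _).trans (hκb 0 (left_mem_Icc.2 zero_le_one))
  have hκ'c : Continuous κ' := continuous_iff_continuousAt.2 fun t => (hκ' t).continuousAt
  have h8 : 8 * κ₀ ≤ C := by nlinarith only [hC0, mul_nonneg hκ₀ hB10, hκ₀]
  refine ⟨fun e _ => ((contDiff_two_ppFarKernelS_u hβ hΛ hB₁ hB₂ hκ hκ' hκ''c hlo e).of_le (by norm_num)).div_const C, ?_,
    fun e _ he u => abs_div_le_of_le (abs_ppFarKernelS_le_inv_max hβ hΛ hB₁ hlo hκb he u).1 hC0 hC (by positivity),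
    farSRow_hK0s hβ hΛ hκb hlo hloΛ hC h8, fun e _ he u => ?_, fun e he u => ?_⟩
  · have h : (fun p : ℝ × ℝ => deriv (fun v : ℝ => ppFarKernelS β Λ κ lo p.1 v / C) p.2) =
        fun p => deriv (fun v : ℝ => ppFarKernelS β Λ κ lo p.1 v) p.2 / C := funext fun p => by rw [deriv_div_const]
    rw [h]
    exact (continuous_deriv_ppFarKernelS₂ hβ hΛ hB₁ hκ hlo hκ'c).div_const C
  · rw [deriv_div_const]
    exact abs_div_le_of_le (abs_deriv_ppFarKernelS_le hβ hΛ hB₁ hB₂ hκ hκb hκ'b ht₀ ht25 hκs hκ's hκ''s hlo he u) hC1 hC (by positivity)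
  · rw [deriv_div_const]
    have he' : |e| ≤ lo := abs_le.2 ⟨he.1, he.2⟩
    exact abs_div_le_of_le (abs_deriv_ppFarKernelS_strip_le hβ hΛ hB₁ hκ hκb hκ'b hlo hloΛ he' u) hCs hC (by positivity)

end FarS

/-- **CONCRETE TWIN FOR `A_s`**: `ppFarKernelS_firstOrderRows` at `sκ := ppSplitProfile t₁` (`ppSplitProfile_admissible`: κ₀ = 1, κ₁ = 6/t₁) and
`C := Cᴬ(B₁,B₂,B₃,t₁)` (`ppSplit_rowConstsFarS`) — the SAME kernel term as the landed `…FarSSplit` umklapp one-calls; kernel inputs `0 < βT`, `0 < Λ`, `|χ′| ≤ B₁`,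
`|χ″| ≤ B₂`, `|χ‴| ≤ B₃`, `0 < t₁ ≤ 2/5`, `0 < lo ≤ Λ` only. [cite: BenfattoGiulianiMastropietro2006, §2.4 (2.36)] -/
theorem ppFarKernelSSplit_firstOrderRows {βT Λ : ℝ} (hkβ : 0 < βT) (hkΛ : 0 < Λ) {B₁ B₂ B₃ : ℝ} (hkB₁ : ∀ x, |deriv salmhoferCutoff x| ≤ B₁)
    (hkB₂ : ∀ x, |deriv (deriv salmhoferCutoff) x| ≤ B₂) (hkB₃ : ∀ x, |deriv (deriv (deriv salmhoferCutoff)) x| ≤ B₃)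
    {t₁ : ℝ} (hkt₀ : 0 < t₁) (hkt25 : t₁ ≤ 2 / 5) {lo hi : ℝ} (hlo0 : 0 < lo) (hkloΛ : lo ≤ Λ) :
    (∀ e ∈ Icc (-hi) hi, ContDiff ℝ 1 (fun v : ℝ => ppFarKernelS βT Λ (ppSplitProfile t₁) lo e v / (1 * (12 * B₁ + 9) +
      (1 * (64 * B₂ + 108 * B₁ + 145) + (6 / t₁) * (12 * B₁ + 9)) +
      (1 * (256 * B₃ + 800 * B₂ + 2592 * B₁ + 1630) + 2 * (6 / t₁) * (64 * B₂ + 108 * B₁ + 145) + (12 * B₁ + 9) * ((8388608 / t₁ ^ 2) + 3 * (6 / t₁))) +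
      (1 * (128 * B₁ + 72) + 8 * (6 / t₁))))) ∧
    (Continuous fun p : ℝ × ℝ => deriv (fun v : ℝ => ppFarKernelS βT Λ (ppSplitProfile t₁) lo p.1 v / (1 * (12 * B₁ + 9) +
      (1 * (64 * B₂ + 108 * B₁ + 145) + (6 / t₁) * (12 * B₁ + 9)) +
      (1 * (256 * B₃ + 800 * B₂ + 2592 * B₁ + 1630) + 2 * (6 / t₁) * (64 * B₂ + 108 * B₁ + 145) + (12 * B₁ + 9) * ((8388608 / t₁ ^ 2) + 3 * (6 / t₁))) +
      (1 * (128 * B₁ + 72) + 8 * (6 / t₁)))) p.2) ∧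
    (∀ e ∈ Icc (-hi) hi, e ≠ 0 → ∀ u, |ppFarKernelS βT Λ (ppSplitProfile t₁) lo e u / (1 * (12 * B₁ + 9) +
      (1 * (64 * B₂ + 108 * B₁ + 145) + (6 / t₁) * (12 * B₁ + 9)) +
      (1 * (256 * B₃ + 800 * B₂ + 2592 * B₁ + 1630) + 2 * (6 / t₁) * (64 * B₂ + 108 * B₁ + 145) + (12 * B₁ + 9) * ((8388608 / t₁ ^ 2) + 3 * (6 / t₁))) +
      (1 * (128 * B₁ + 72) + 8 * (6 / t₁)))| ≤ (max |e| |u|)⁻¹) ∧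
    (∀ e ∈ Icc (-lo) lo, ∀ u, |ppFarKernelS βT Λ (ppSplitProfile t₁) lo e u / (1 * (12 * B₁ + 9) +
      (1 * (64 * B₂ + 108 * B₁ + 145) + (6 / t₁) * (12 * B₁ + 9)) +
      (1 * (256 * B₃ + 800 * B₂ + 2592 * B₁ + 1630) + 2 * (6 / t₁) * (64 * B₂ + 108 * B₁ + 145) + (12 * B₁ + 9) * ((8388608 / t₁ ^ 2) + 3 * (6 / t₁))) +
      (1 * (128 * B₁ + 72) + 8 * (6 / t₁)))| ≤ (max lo |u|)⁻¹) ∧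
    (∀ e ∈ Icc (-hi) hi, e ≠ 0 → ∀ u, |deriv (fun v : ℝ => ppFarKernelS βT Λ (ppSplitProfile t₁) lo e v / (1 * (12 * B₁ + 9) +
      (1 * (64 * B₂ + 108 * B₁ + 145) + (6 / t₁) * (12 * B₁ + 9)) +
      (1 * (256 * B₃ + 800 * B₂ + 2592 * B₁ + 1630) + 2 * (6 / t₁) * (64 * B₂ + 108 * B₁ + 145) + (12 * B₁ + 9) * ((8388608 / t₁ ^ 2) + 3 * (6 / t₁))) +
      (1 * (128 * B₁ + 72) + 8 * (6 / t₁)))) u| ≤ (max |e| |u|)⁻¹ ^ 2) ∧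
    (∀ e ∈ Icc (-lo) lo, ∀ u, |deriv (fun v : ℝ => ppFarKernelS βT Λ (ppSplitProfile t₁) lo e v / (1 * (12 * B₁ + 9) +
      (1 * (64 * B₂ + 108 * B₁ + 145) + (6 / t₁) * (12 * B₁ + 9)) +
      (1 * (256 * B₃ + 800 * B₂ + 2592 * B₁ + 1630) + 2 * (6 / t₁) * (64 * B₂ + 108 * B₁ + 145) + (12 * B₁ + 9) * ((8388608 / t₁ ^ 2) + 3 * (6 / t₁))) +
      (1 * (128 * B₁ + 72) + 8 * (6 / t₁)))) u| ≤ (max lo |u|)⁻¹ ^ 2) := by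
  obtain ⟨h1, h2, h3, h4, h5, -, h7, h8, h9⟩ := ppSplitProfile_admissible hkt₀
  obtain ⟨hC, hC0, hC1, -, hCs⟩ := ppSplit_rowConstsFarS (salmhoferB₁_nonneg hkB₁) (salmhoferB₂_nonneg hkB₂) ((abs_nonneg _).trans (hkB₃ 0)) hkt₀
  exact ppFarKernelS_firstOrderRows hkβ hkΛ hkB₁ hkB₂ h1 h2 h3 h4 h5 hkt₀ hkt25 h7 h8 h9 hlo0 hkloΛ hC hC0 hC1 hCs

/-! ## §3 The comparable-levels piece `M_s/C` -/

section MidS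

variable {β Λ : ℝ} (hβ : 0 < β) (hΛ : 0 < Λ) {B₁ B₂ : ℝ} (hB₁ : ∀ x, |deriv salmhoferCutoff x| ≤ B₁) (hB₂ : ∀ x, |deriv (deriv salmhoferCutoff) x| ≤ B₂)
  {κ κ' κ'' : ℝ → ℝ} (hκ : ∀ t, HasDerivAt κ (κ' t) t) (hκ' : ∀ t, HasDerivAt κ' (κ'' t) t) (hκ''c : Continuous κ'')
  {κ₀ κ₁ : ℝ} (hκb : ∀ t ∈ Icc 0 1, |κ t| ≤ κ₀) (hκ'b : ∀ t ∈ Icc 0 1, |κ' t| ≤ κ₁)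
  {t₁ : ℝ} (ht₀ : 0 < t₁) (ht25 : t₁ ≤ 2 / 5)
  (hκs : ∀ t, t₁ ≤ t → κ t = 0) (hκ's : ∀ t, t₁ ≤ t → κ' t = 0)
  (hκ1 : ∀ t, t ≤ t₁ / 2 → κ t = 1) (hκ'1 : ∀ t, t ≤ t₁ / 2 → κ' t = 0)
  {lo hi C : ℝ} (hlo : 0 < lo) (hloΛ : lo ≤ Λ) (hC : 0 < C)

set_option maxHeartbeats 400000 in
include hβ hΛ hB₁ hB₂ hκ hκ' hκ''c hκb hκ'b ht₀ ht25 hκs hκ's hκ1 hκ'1 hlo hloΛ hC in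
/-- **THE SIX ROWS OF B-1 (vi) FOR `Kr := M_s/C`** (binder order `hKd, hKc, hK0, hK0s, hK1, hKs1`): normalisation `C₀ᴹ = (1+2κ₀)(12B₁+9) ≤ C`,
`C₁ᴹ = (1+2κ₀)(128B₂+216B₁+294+(48B₁+28)q′) + 2κ₁(12B₁+9) ≤ C` (`q′ = (2−t₁)/t₁`), `Cˢᴹ = (1+2κ₀)(128B₁+72) + 16κ₁ ≤ C`; profile `κ` of class `C²`,
`|κ| ≤ κ₀`, `|κ′| ≤ κ₁` on `[0,1]`, dead above `t₁ ≤ 2/5`, `κ = 1` flat below `t₁/2`. [cite: BenfattoGiulianiMastropietro2006, §2.4 (2.36)] -/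
theorem ppMidKernelS_firstOrderRows (hC0 : (1 + 2 * κ₀) * (12 * B₁ + 9) ≤ C)
    (hC1 : (1 + 2 * κ₀) * (128 * B₂ + 216 * B₁ + 294 + (48 * B₁ + 28) * ((2 - t₁) / t₁)) + 2 * κ₁ * (12 * B₁ + 9) ≤ C)
    (hCs : (1 + 2 * κ₀) * (128 * B₁ + 72) + 16 * κ₁ ≤ C) :
    (∀ e ∈ Icc (-hi) hi, ContDiff ℝ 1 (fun v : ℝ => ppMidKernelS β Λ κ lo e v / C)) ∧
    (Continuous fun p : ℝ × ℝ => deriv (fun v : ℝ => ppMidKernelS β Λ κ lo p.1 v / C) p.2) ∧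
    (∀ e ∈ Icc (-hi) hi, e ≠ 0 → ∀ u, |ppMidKernelS β Λ κ lo e u / C| ≤ (max |e| |u|)⁻¹) ∧
    (∀ e ∈ Icc (-lo) lo, ∀ u, |ppMidKernelS β Λ κ lo e u / C| ≤ (max lo |u|)⁻¹) ∧
    (∀ e ∈ Icc (-hi) hi, e ≠ 0 → ∀ u, |deriv (fun v : ℝ => ppMidKernelS β Λ κ lo e v / C) u| ≤ (max |e| |u|)⁻¹ ^ 2) ∧
    (∀ e ∈ Icc (-lo) lo, ∀ u, |deriv (fun v : ℝ => ppMidKernelS β Λ κ lo e v / C) u| ≤ (max lo |u|)⁻¹ ^ 2) := by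
  have hB10 : 0 ≤ B₁ := salmhoferB₁_nonneg hB₁
  have hκ₀ : 0 ≤ κ₀ := (abs_nonneg _).trans (hκb 0 (left_mem_Icc.2 zero_le_one))
  have hκ'c : Continuous κ' := continuous_iff_continuousAt.2 fun t => (hκ' t).continuousAt
  have h8 : 8 * (1 + 2 * κ₀) ≤ C := by nlinarith only [hC0, mul_nonneg hκ₀ hB10, hκ₀, hB10]
  refine ⟨fun e _ => ((contDiff_two_ppMidKernelS_u hβ hΛ hB₁ hB₂ hκ hκ' hκ''c hlo e).of_le (by norm_num)).div_const C, ?_,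
    fun e _ he u => abs_div_le_of_le (abs_ppFarKernelS_le_inv_max hβ hΛ hB₁ hlo hκb he u).2 hC0 hC (by positivity),
    midSRow_hK0s hβ hΛ hκb hlo hloΛ hC h8, fun e _ he u => ?_, fun e he u => ?_⟩
  · have h : (fun p : ℝ × ℝ => deriv (fun v : ℝ => ppMidKernelS β Λ κ lo p.1 v / C) p.2) =
        fun p => deriv (fun v : ℝ => ppMidKernelS β Λ κ lo p.1 v) p.2 / C := funext fun p => by rw [deriv_div_const]
    rw [h]
    exact (continuous_deriv_ppMidKernelS₂ hβ hΛ hB₁ hκ hlo hκ'c).div_const C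
  · rw [deriv_div_const]
    exact abs_div_le_of_le (abs_deriv_ppMidKernelS_le_abs hβ hΛ hB₁ hB₂ hκ hκb hκ'b ht₀ ht25 hκs hκ's hκ1 hκ'1 hlo hloΛ he u) hC1 hC (by positivity)
  · rw [deriv_div_const]
    have he' : |e| ≤ lo := abs_le.2 ⟨he.1, he.2⟩
    exact abs_div_le_of_le (abs_deriv_ppMidKernelS_strip_le hβ hΛ hB₁ hκ hκb hκ'b hlo hloΛ he' u) hCs hC (by positivity)

end MidS

set_option maxHeartbeats 400000 in
/-- **CONCRETE TWIN FOR `M_s`**: `ppMidKernelS_firstOrderRows` at `sκ := ppSplitProfile t₁` (`ppSplitProfile_admissible`, `ppSplitProfile_admissible_mid`) and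
`C := Cᴹ(B₁,B₂,B₃,t₁)` (`ppSplit_rowConstsMidS`) — the SAME kernel term as the landed `…MidSSplit` umklapp one-calls; kernel inputs `0 < βT`, `0 < Λ`, `|χ′| ≤ B₁`,
`|χ″| ≤ B₂`, `|χ‴| ≤ B₃`, `0 < t₁ ≤ 2/5`, `0 < lo ≤ Λ` only. [cite: BenfattoGiulianiMastropietro2006, §2.4 (2.36)] -/
theorem ppMidKernelSSplit_firstOrderRows {βT Λ : ℝ} (hkβ : 0 < βT) (hkΛ : 0 < Λ) {B₁ B₂ B₃ : ℝ} (hkB₁ : ∀ x, |deriv salmhoferCutoff x| ≤ B₁)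
    (hkB₂ : ∀ x, |deriv (deriv salmhoferCutoff) x| ≤ B₂) (hkB₃ : ∀ x, |deriv (deriv (deriv salmhoferCutoff)) x| ≤ B₃)
    {t₁ : ℝ} (hkt₀ : 0 < t₁) (hkt25 : t₁ ≤ 2 / 5) {lo hi : ℝ} (hlo0 : 0 < lo) (hkloΛ : lo ≤ Λ) :
    (∀ e ∈ Icc (-hi) hi, ContDiff ℝ 1 (fun v : ℝ => ppMidKernelS βT Λ (ppSplitProfile t₁) lo e v / ((1 + 2 * 1) * (12 * B₁ + 9) +
      ((1 + 2 * 1) * (128 * B₂ + 216 * B₁ + 294 + (48 * B₁ + 28) * ((2 - t₁) / t₁)) + 2 * (6 / t₁) * (12 * B₁ + 9)) +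
      ((1 + 2 * 1) * (512 * B₃ + 1664 * B₂ + 5280 * B₁ + 3424 + (256 * B₂ + 384 * B₁ + 504) * ((2 - t₁) / t₁) ^ 2 + (192 * B₁ + 112) * ((2 - t₁) / t₁)) +
          4 * (6 / t₁) * (128 * B₂ + 216 * B₁ + 294 + (48 * B₁ + 28) * ((2 - t₁) / t₁)) +
          (12 * B₁ + 9) * (2 * (8388608 / t₁ ^ 2) + 2 * (6 / t₁) * ((2 - t₁) / t₁ + 2))) +
      ((1 + 2 * 1) * (128 * B₁ + 72) + 16 * (6 / t₁))))) ∧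
    (Continuous fun p : ℝ × ℝ => deriv (fun v : ℝ => ppMidKernelS βT Λ (ppSplitProfile t₁) lo p.1 v / ((1 + 2 * 1) * (12 * B₁ + 9) +
      ((1 + 2 * 1) * (128 * B₂ + 216 * B₁ + 294 + (48 * B₁ + 28) * ((2 - t₁) / t₁)) + 2 * (6 / t₁) * (12 * B₁ + 9)) +
      ((1 + 2 * 1) * (512 * B₃ + 1664 * B₂ + 5280 * B₁ + 3424 + (256 * B₂ + 384 * B₁ + 504) * ((2 - t₁) / t₁) ^ 2 + (192 * B₁ + 112) * ((2 - t₁) / t₁)) +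
          4 * (6 / t₁) * (128 * B₂ + 216 * B₁ + 294 + (48 * B₁ + 28) * ((2 - t₁) / t₁)) +
          (12 * B₁ + 9) * (2 * (8388608 / t₁ ^ 2) + 2 * (6 / t₁) * ((2 - t₁) / t₁ + 2))) +
      ((1 + 2 * 1) * (128 * B₁ + 72) + 16 * (6 / t₁)))) p.2) ∧
    (∀ e ∈ Icc (-hi) hi, e ≠ 0 → ∀ u, |ppMidKernelS βT Λ (ppSplitProfile t₁) lo e u / ((1 + 2 * 1) * (12 * B₁ + 9) +
      ((1 + 2 * 1) * (128 * B₂ + 216 * B₁ + 294 + (48 * B₁ + 28) * ((2 - t₁) / t₁)) + 2 * (6 / t₁) * (12 * B₁ + 9)) +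
      ((1 + 2 * 1) * (512 * B₃ + 1664 * B₂ + 5280 * B₁ + 3424 + (256 * B₂ + 384 * B₁ + 504) * ((2 - t₁) / t₁) ^ 2 + (192 * B₁ + 112) * ((2 - t₁) / t₁)) +
          4 * (6 / t₁) * (128 * B₂ + 216 * B₁ + 294 + (48 * B₁ + 28) * ((2 - t₁) / t₁)) +
          (12 * B₁ + 9) * (2 * (8388608 / t₁ ^ 2) + 2 * (6 / t₁) * ((2 - t₁) / t₁ + 2))) +
      ((1 + 2 * 1) * (128 * B₁ + 72) + 16 * (6 / t₁)))| ≤ (max |e| |u|)⁻¹) ∧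
    (∀ e ∈ Icc (-lo) lo, ∀ u, |ppMidKernelS βT Λ (ppSplitProfile t₁) lo e u / ((1 + 2 * 1) * (12 * B₁ + 9) +
      ((1 + 2 * 1) * (128 * B₂ + 216 * B₁ + 294 + (48 * B₁ + 28) * ((2 - t₁) / t₁)) + 2 * (6 / t₁) * (12 * B₁ + 9)) +
      ((1 + 2 * 1) * (512 * B₃ + 1664 * B₂ + 5280 * B₁ + 3424 + (256 * B₂ + 384 * B₁ + 504) * ((2 - t₁) / t₁) ^ 2 + (192 * B₁ + 112) * ((2 - t₁) / t₁)) +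
          4 * (6 / t₁) * (128 * B₂ + 216 * B₁ + 294 + (48 * B₁ + 28) * ((2 - t₁) / t₁)) +
          (12 * B₁ + 9) * (2 * (8388608 / t₁ ^ 2) + 2 * (6 / t₁) * ((2 - t₁) / t₁ + 2))) +
      ((1 + 2 * 1) * (128 * B₁ + 72) + 16 * (6 / t₁)))| ≤ (max lo |u|)⁻¹) ∧
    (∀ e ∈ Icc (-hi) hi, e ≠ 0 → ∀ u, |deriv (fun v : ℝ => ppMidKernelS βT Λ (ppSplitProfile t₁) lo e v / ((1 + 2 * 1) * (12 * B₁ + 9) +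
      ((1 + 2 * 1) * (128 * B₂ + 216 * B₁ + 294 + (48 * B₁ + 28) * ((2 - t₁) / t₁)) + 2 * (6 / t₁) * (12 * B₁ + 9)) +
      ((1 + 2 * 1) * (512 * B₃ + 1664 * B₂ + 5280 * B₁ + 3424 + (256 * B₂ + 384 * B₁ + 504) * ((2 - t₁) / t₁) ^ 2 + (192 * B₁ + 112) * ((2 - t₁) / t₁)) +
          4 * (6 / t₁) * (128 * B₂ + 216 * B₁ + 294 + (48 * B₁ + 28) * ((2 - t₁) / t₁)) +
          (12 * B₁ + 9) * (2 * (8388608 / t₁ ^ 2) + 2 * (6 / t₁) * ((2 - t₁) / t₁ + 2))) +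
      ((1 + 2 * 1) * (128 * B₁ + 72) + 16 * (6 / t₁)))) u| ≤ (max |e| |u|)⁻¹ ^ 2) ∧
    (∀ e ∈ Icc (-lo) lo, ∀ u, |deriv (fun v : ℝ => ppMidKernelS βT Λ (ppSplitProfile t₁) lo e v / ((1 + 2 * 1) * (12 * B₁ + 9) +
      ((1 + 2 * 1) * (128 * B₂ + 216 * B₁ + 294 + (48 * B₁ + 28) * ((2 - t₁) / t₁)) + 2 * (6 / t₁) * (12 * B₁ + 9)) +
      ((1 + 2 * 1) * (512 * B₃ + 1664 * B₂ + 5280 * B₁ + 3424 + (256 * B₂ + 384 * B₁ + 504) * ((2 - t₁) / t₁) ^ 2 + (192 * B₁ + 112) * ((2 - t₁) / t₁)) +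
          4 * (6 / t₁) * (128 * B₂ + 216 * B₁ + 294 + (48 * B₁ + 28) * ((2 - t₁) / t₁)) +
          (12 * B₁ + 9) * (2 * (8388608 / t₁ ^ 2) + 2 * (6 / t₁) * ((2 - t₁) / t₁ + 2))) +
      ((1 + 2 * 1) * (128 * B₁ + 72) + 16 * (6 / t₁)))) u| ≤ (max lo |u|)⁻¹ ^ 2) := by
  obtain ⟨h1, h2, h3, h4, h5, -, h7, h8, -⟩ := ppSplitProfile_admissible hkt₀
  obtain ⟨h10, h11, -⟩ := ppSplitProfile_admissible_mid hkt₀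
  obtain ⟨hC, hC0, hC1, -, hCs⟩ := ppSplit_rowConstsMidS (salmhoferB₁_nonneg hkB₁) (salmhoferB₂_nonneg hkB₂) ((abs_nonneg _).trans (hkB₃ 0)) hkt₀ hkt25
  exact ppMidKernelS_firstOrderRows hkβ hkΛ hkB₁ hkB₂ h1 h2 h3 h4 h5 hkt₀ hkt25 h7 h8 h10 h11 hlo0 hkloΛ hC hC0 hC1 hCs

end Summit.HubbardSuperconductivity.HubbardSuperconductivity.Theorems.C4a

end
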